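import Summits.QuantumFields.YangMills.Theorems.LuscherReductionTwistedTraceScalingTrackDefs
import Summits.QuantumFields.YangMills.Theorems.LuscherReductionTwistedTraceScalingBaseWindow
import Summits.QuantumFields.YangMills.Theorems.LuscherReductionRunningReductionBOHandoverLabels
import HarnessLib

/-!
# TRACK LEMMAS for the registered stub `stub_labelTracking : Stmt.stub_labelTracking` of line «twolattice» skeleton rev 3 (crux `TwistedTraceScaling`,
# stmt-QuantumFields-20203): units, the three vanishing log brackets of the junction, and the clause computations (label-side real analysis)

Route `LuscherReduction` (owner ym-beyond-p1), crux `TwistedTraceScaling` (stmt-QuantumFields-20203), line «twolattice», skeleton rev 3 «two-loop calibration»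
(owner g29, sha16 1a2ae9b1ae61a9c5, registered 2026-08-27T15:26Z; stubs S-BASE · CMP-2LOOP · TRACK).  LEAD ym-lead-20203-twolattice g1.
TRACK (size L, «pure real analysis on the label and on two-loop flows») says: for every block factor `M ≥ 2`, tolerance `δ`, femto time `s` and family `φ` with
`Stmt.twoLoopLawH (stepBal 2 M) (twoLoopStepBal M) φ`, deep enough in the femto windows (`lam ≤ lam1(M, δ, s, φ)`), label matching
`invRunningCoupling β₁ b = invRunningCoupling β L` on an E1 pair with `1 ≤ β₁` forces (i) the calibrator `x̂ = flowInvSq φ β (k+1) ≥ 1/(4lam³)`, (ii)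
`|x̂ − 2β₁| ≤ δ·2β₁`, (iii) `|femtoSteps s β L · calLambda φ β (k+1) b / L − s| ≤ δ`.

This file = the label-side lemmas of the proof (vocabulary = the re-homed `…TrackDefs`; the run engine is `…TrackRun` / `…TwoLoopFlow`; the stub itself is
assembled in `…TrackStub`):
* §1 units: `stepBal 2 M = 8b₀ log M`, `twoLoopStepBal M / stepBal 2 M = 4b₁/b₀ =: κ`, `1/bareBal β² = 2β`;
* §2 the three LOG BRACKETS of the junction vanish identically (budget / coupling / calibrated label) — the two-loop terms of the label CANCEL against the flow's
  two-loop logarithm, as in the lead's RG plan (S2) and the owner's RG-KIT F4;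
* §3 elementary: `|x − y − κ log(x/y)| ≤ C`, `x, y ≥ 2κ` ⇒ `|x − y| ≤ 2C`; `|t − 1| ≤ |t³ − 1|` for `t > 0`;
* §4 window/tower bookkeeping: `v := invRunningCoupling β L ≥ 1/(8lam³)`, `2β ≥ 4v` (uses `1 ≤ β`), `0 ≤ log L − log b − (k+1) log M ≤ 1/2`;
* §4 `window_facts` (`v ≥ 1/(8lam³)`, `Λ³ = 1/v`, `2v ≤ β`), `tower_logs` (`0 ≤ θ ≤ 1/2`), `clause_ii` (`|x̂ − 2β₁| ≤ 2(4b₀ + E₀)`), `clause_iii_label`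
  (`|invRunningCoupling (x̂/2) b − v| ≤ b₀ + E₀/4`), `clause_iii_cube`, `clause_iii_time` — the three clause computations from the two-loop endpoint estimate.

HONEST FRAMING: real analysis about hypothetical two-loop flow families and the tree's label; W-FLOW for Bałaban's true flow and CMP-2LOOP are OPEN (not in
print); femto rung R2b1 of a CONDITIONAL reduction route; nothing here bears on infinite volume, a mass gap, or Clay.  No new definitions.
-/

set_option autoImplicit false

noncomputable section

open Real
open scoped BigOperators

namespace Summit.QuantumFields.YangMills.Theorems.FemtoTransferGap.TwoLattice

open Summit.QuantumFields.YangMills.Theorems.FemtoTransferGap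
open Summit.QuantumFields.YangMills.Theorems.FemtoTransferGap.TraceDoor
open Literature.MathematicalPhysics.QuantumFieldTheory.Balaban1983to89

namespace Track

/-! ## §1 Units -/

/-- `stepBal 2 M = 8·b₀·log M` (Bałaban's one-loop step for SU(2) in the tree's `b₀ = 11/(24π²)`). [cite: Balaban1987RG1, (0.31) p.259] -/
theorem stepBal_two_eq (M : ℝ) : B12Normalization.stepBal 2 M = 8 * b0 * Real.log M := by
  rw [B12Normalization.stepBal_two]; unfold b0; ring

/-- `κ := twoLoopStepBal M / stepBal 2 M = 4 b₁/b₀` for `M ≥ 2`. [cite: MontvayMunster1994, (5.66) §5.1] -/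
theorem kappa_eq {M : ℕ} (hM : 2 ≤ M) : twoLoopStepBal M / B12Normalization.stepBal 2 M = 4 * b1 / b0 := by
  rw [stepBal_two_eq]; unfold twoLoopStepBal
  have hlog : 0 < Real.log (M : ℝ) := Real.log_pos (by exact_mod_cast (lt_of_lt_of_le (by norm_num) hM : 1 < M))
  have hb0 : 0 < b0 := by unfold b0; positivity
  field_simp
  ring

/-- `1/bareBal β² = 2β` for `β > 0`. [cite: Balaban1987RG1, (0.20) p.256] -/
theorem one_div_bareBal_sq {β : ℝ} (hβ : 0 < β) : 1 / bareBal β ^ 2 = 2 * β := by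
  unfold bareBal
  rw [div_pow, one_pow, Real.sq_sqrt (by positivity), one_div_one_div]

/-- `bareBal β > 0` for `β > 0`. [folklore] -/
theorem bareBal_pos {β : ℝ} (hβ : 0 < β) : 0 < bareBal β := by
  unfold bareBal; positivity

/-! ## §2 The three log brackets of the junction (atoms as in `BOHandover.invRunningCoupling_eq`) -/

/-- Budget bracket: `−log(2b₀/β) − log(2β/X) = log X − log(4b₀)` (`β, X > 0`). [folklore] -/
theorem log_bracket_budget {β X : ℝ} (hβ : 0 < β) (hX : 0 < X) :
    -Real.log (2 * b0 / β) - Real.log (2 * β / X) = Real.log X - Real.log (4 * b0) := by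
  have hb0 : 0 < b0 := by unfold b0; positivity
  have h4 : Real.log (4 * b0) = 2 * Real.log 2 + Real.log b0 := by
    rw [Real.log_mul (by norm_num) hb0.ne', show (4 : ℝ) = 2 ^ 2 by norm_num, Real.log_pow]; push_cast; ring
  rw [Real.log_div (by positivity) hβ.ne', Real.log_div (by positivity) hX.ne', Real.log_mul (by norm_num) hβ.ne',
    Real.log_mul (by norm_num) hb0.ne', h4]
  ring

/-- Coupling bracket: `−log(2b₀/β) − log(2β/x) + log(2b₀/β₁) − log(x/(2β₁)) = 0` (`β, β₁, x > 0`). [folklore] -/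
theorem log_bracket_coupling {β β₁ x : ℝ} (hβ : 0 < β) (hβ₁ : 0 < β₁) (hx : 0 < x) :
    -Real.log (2 * b0 / β) - Real.log (2 * β / x) + Real.log (2 * b0 / β₁) - Real.log (x / (2 * β₁)) = 0 := by
  have hb0 : 0 < b0 := by unfold b0; positivity
  rw [Real.log_div (by positivity) hβ.ne', Real.log_div (by positivity) hx.ne', Real.log_div (by positivity) hβ₁.ne',
    Real.log_div hx.ne' (by positivity), Real.log_mul (by norm_num) hβ.ne', Real.log_mul (by norm_num) hb0.ne',
    Real.log_mul (by norm_num) hβ₁.ne']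
  ring

/-- Calibrated-label bracket: `−log(2b₀/β) − log(2β/x) + log(2b₀/(x/2)) = 0` (`β, x > 0`). [folklore] -/
theorem log_bracket_label {β x : ℝ} (hβ : 0 < β) (hx : 0 < x) :
    -Real.log (2 * b0 / β) - Real.log (2 * β / x) + Real.log (2 * b0 / (x / 2)) = 0 := by
  have hb0 : 0 < b0 := by unfold b0; positivity
  rw [Real.log_div (by positivity) hβ.ne', Real.log_div (by positivity) hx.ne', Real.log_div (by positivity) (by positivity),
    Real.log_div hx.ne' (by norm_num), Real.log_mul (by norm_num) hβ.ne', Real.log_mul (by norm_num) hb0.ne']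
  ring

/-! ## §3 Elementary real lemmas -/

/-- `|x − y − κ log(x/y)| ≤ C` with `x, y ≥ 2κ > … ` (`κ ≥ 0`, `x, y > 0`) forces `|x − y| ≤ 2C`. [folklore] -/
theorem abs_sub_le_of_log {x y κ C : ℝ} (hκ : 0 ≤ κ) (hx : 0 < x) (hy : 0 < y) (hxκ : 2 * κ ≤ x) (hyκ : 2 * κ ≤ y)
    (h : |x - y - κ * Real.log (x / y)| ≤ C) : |x - y| ≤ 2 * C := by
  obtain ⟨hlo, hhi⟩ := abs_le.1 h
  rw [abs_le]
  by_cases hxy : y ≤ x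
  · -- `log(x/y) ≤ x/y − 1 = (x−y)/y`, so `x − y ≤ C + κ (x−y)/y ≤ C + (x−y)/2`
    have h1 : Real.log (x / y) ≤ (x - y) / y := by
      have := Real.log_le_sub_one_of_pos (div_pos hx hy)
      rw [div_sub_one hy.ne'] at this; exact this
    have h2 : κ * Real.log (x / y) ≤ (x - y) / 2 := by
      calc κ * Real.log (x / y) ≤ κ * ((x - y) / y) := mul_le_mul_of_nonneg_left h1 hκ
        _ = (κ / y) * (x - y) := by ring
        _ ≤ (1 / 2) * (x - y) := by
            apply mul_le_mul_of_nonneg_right _ (by linarith)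
            rw [div_le_iff₀ hy]; linarith
        _ = (x - y) / 2 := by ring
    have h0 : 0 ≤ Real.log (x / y) := Real.log_nonneg (by rw [le_div_iff₀ hy]; linarith)
    constructor <;> nlinarith
  · rw [not_le] at hxy
    have h1 : Real.log (y / x) ≤ (y - x) / x := by
      have := Real.log_le_sub_one_of_pos (div_pos hy hx)
      rw [div_sub_one hx.ne'] at this; exact this
    have hrel : Real.log (x / y) = -Real.log (y / x) := by
      rw [← Real.log_inv, inv_div]
    have h2 : κ * Real.log (y / x) ≤ (y - x) / 2 := by
      calc κ * Real.log (y / x) ≤ κ * ((y - x) / x) := mul_le_mul_of_nonneg_left h1 hκ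
        _ = (κ / x) * (y - x) := by ring
        _ ≤ (1 / 2) * (y - x) := by
            apply mul_le_mul_of_nonneg_right _ (by linarith)
            rw [div_le_iff₀ hx]; linarith
        _ = (y - x) / 2 := by ring
    have h0 : 0 ≤ Real.log (y / x) := Real.log_nonneg (by rw [le_div_iff₀ hx]; linarith)
    rw [hrel] at hlo hhi
    constructor <;> nlinarith

/-- For `t > 0`: `|t − 1| ≤ |t³ − 1|`. [folklore] -/
theorem abs_sub_one_le_abs_cube {t : ℝ} (ht : 0 < t) : |t - 1| ≤ |t ^ 3 - 1| := by
  by_cases h1 : 1 ≤ t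
  · have : t ≤ t ^ 3 := by nlinarith [sq_nonneg t]
    rw [abs_of_nonneg (by linarith), abs_of_nonneg (by nlinarith)]
    linarith
  · rw [not_le] at h1
    have : t ^ 3 ≤ t := by nlinarith [sq_nonneg t]
    rw [abs_of_neg (by linarith), abs_of_nonpos (by nlinarith)]
    linarith

/-! ## §4 Window / tower bookkeeping and the two clause computations -/

/-- In the femto window at depth `lam`: `v := invRunningCoupling β L > 0`, `Λ³ = 1/v`, `1/(8lam³) ≤ v` (from `Λ ≤ 2lam`), and `2v ≤ β` (from `1 ≤ β`).
[cite: LuscherMunster1984, §2] -/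
theorem window_facts {lam β : ℝ} {L : ℕ} [NeZero L] (hlam : 0 < lam) (hW : InFemtoWindow lam β L) :
    0 < invRunningCoupling β L ∧ luscherLambda β L ^ 3 = (invRunningCoupling β L)⁻¹ ∧
      1 / (8 * lam ^ 3) ≤ invRunningCoupling β L ∧ 2 * invRunningCoupling β L ≤ β := by
  have hΛ : 0 < luscherLambda β L := luscherLambda_pos_of_window hlam hW
  have hv : 0 < invRunningCoupling β L := BOHandover.invRunningCoupling_pos_of_luscherLambda_pos hΛ
  have h3 : luscherLambda β L ^ 3 = (invRunningCoupling β L)⁻¹ := BOHandover.luscherLambda_pow_three hv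
  refine ⟨hv, h3, ?_, ?_⟩
  · have hle : luscherLambda β L ^ 3 ≤ (2 * lam) ^ 3 := pow_le_pow_left₀ hΛ.le hW.2.2 3
    rw [h3] at hle
    have : (invRunningCoupling β L)⁻¹ ≤ 8 * lam ^ 3 := by nlinarith
    rw [one_div]
    exact inv_le_of_inv_le₀ hv this
  · have := BOHandover.invRunningCoupling_le_half hW.1 L
    linarith

/-- E1 tower logarithms: for `M ≥ 2`, `b ≥ 1`, `b·M^{k+1} ≤ L < b·M^k·(M+1)` the defect `θ := log L − log b − (k+1) log M` satisfies `0 ≤ θ ≤ 1/2`, and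
`(k+1) log M ≤ log L`. [folklore] -/
theorem tower_logs {M b k L : ℕ} (hM : 2 ≤ M) (hb : 1 ≤ b) (hbL : b * M ^ (k + 1) ≤ L) (hLb : L < b * M ^ k * (M + 1)) :
    0 ≤ Real.log (L : ℝ) - Real.log (b : ℝ) - ((k : ℝ) + 1) * Real.log (M : ℝ) ∧
    Real.log (L : ℝ) - Real.log (b : ℝ) - ((k : ℝ) + 1) * Real.log (M : ℝ) ≤ 1 / 2 ∧
    ((k : ℝ) + 1) * Real.log (M : ℝ) ≤ Real.log (L : ℝ) := by
  have hM0 : (0 : ℝ) < M := by exact_mod_cast (lt_of_lt_of_le (by norm_num) hM : 0 < M)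
  have hM2 : (2 : ℝ) ≤ M := by exact_mod_cast hM
  have hb0 : (0 : ℝ) < b := by exact_mod_cast (lt_of_lt_of_le (by norm_num) hb : 0 < b)
  have hb1 : (1 : ℝ) ≤ b := by exact_mod_cast hb
  have hlow : (b : ℝ) * (M : ℝ) ^ (k + 1) ≤ L := by exact_mod_cast hbL
  have hup : (L : ℝ) < (b : ℝ) * (M : ℝ) ^ k * ((M : ℝ) + 1) := by exact_mod_cast hLb
  have hprod : 0 < (b : ℝ) * (M : ℝ) ^ (k + 1) := by positivity
  have hL0 : (0 : ℝ) < L := lt_of_lt_of_le hprod hlow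
  have hlogb : 0 ≤ Real.log (b : ℝ) := Real.log_nonneg hb1
  have h1 : Real.log ((b : ℝ) * (M : ℝ) ^ (k + 1)) = Real.log (b : ℝ) + ((k : ℝ) + 1) * Real.log (M : ℝ) := by
    rw [Real.log_mul hb0.ne' (by positivity), Real.log_pow]; push_cast; ring
  have h2 : Real.log ((b : ℝ) * (M : ℝ) ^ k * ((M : ℝ) + 1)) = Real.log (b : ℝ) + (k : ℝ) * Real.log (M : ℝ) + Real.log ((M : ℝ) + 1) := by
    rw [Real.log_mul (by positivity) (by positivity), Real.log_mul hb0.ne' (by positivity), Real.log_pow]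
  have hle : Real.log ((b : ℝ) * (M : ℝ) ^ (k + 1)) ≤ Real.log (L : ℝ) := Real.log_le_log hprod hlow
  have hlt : Real.log (L : ℝ) < Real.log ((b : ℝ) * (M : ℝ) ^ k * ((M : ℝ) + 1)) := Real.log_lt_log hL0 hup
  rw [h1] at hle; rw [h2] at hlt
  have hM1 : Real.log ((M : ℝ) + 1) - Real.log (M : ℝ) ≤ 1 / 2 := by
    rw [← Real.log_div (by positivity) hM0.ne']
    have : Real.log (((M : ℝ) + 1) / M) ≤ ((M : ℝ) + 1) / M - 1 := Real.log_le_sub_one_of_pos (by positivity)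
    have h' : ((M : ℝ) + 1) / M - 1 = 1 / M := by field_simp; ring
    rw [h'] at this
    exact this.trans (by rw [div_le_div_iff_of_pos_left one_pos hM0 (by norm_num)]; exact hM2)
  refine ⟨by linarith, by linarith, by linarith⟩

/-- **Clause (ii) computation.**  With the label identities `2β = 4v + 8b₀·log L − κ·log(2b₀/β)`, `2β₁ = 4v + 8b₀·log b − κ·log(2b₀/β₁)` (`κ = 4b₁/b₀`, equal
labels), the tower defect `0 ≤ θ ≤ 1/2` and the two-loop endpoint estimate `|x − (2β − 8b₀A − κ log(2β/x))| ≤ E₀` (`A = (k+1) log M`), the calibrator and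
the base bare value satisfy `|x − 2β₁ − κ log(x/(2β₁))| ≤ 4b₀ + E₀`, hence `|x − 2β₁| ≤ 2(4b₀ + E₀)` once both are `≥ 2κ`. [cite: LuscherMunster1984, §2] -/
theorem clause_ii {x β β₁ v κ E₀ lL lb A : ℝ} (hκ0 : 0 ≤ κ) (hx : 0 < x) (hβ : 0 < β) (hβ₁ : 0 < β₁)
    (h2β : 2 * β = 4 * v + 8 * b0 * lL - κ * Real.log (2 * b0 / β))
    (h2β₁ : 2 * β₁ = 4 * v + 8 * b0 * lb - κ * Real.log (2 * b0 / β₁))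
    (hθ0 : 0 ≤ lL - lb - A) (hθ1 : lL - lb - A ≤ 1 / 2)
    (hend : |x - (2 * β - 8 * b0 * A - κ * Real.log (2 * β / x))| ≤ E₀)
    (hxκ : 2 * κ ≤ x) (hyκ : 2 * κ ≤ 2 * β₁) : |x - 2 * β₁| ≤ 2 * (4 * b0 + E₀) := by
  have hb0 : 0 < b0 := by unfold b0; positivity
  have hbr := log_bracket_coupling hβ hβ₁ hx
  have key : x - 2 * β₁ - κ * Real.log (x / (2 * β₁)) =
      (x - (2 * β - 8 * b0 * A - κ * Real.log (2 * β / x))) + 8 * b0 * (lL - lb - A) := by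
    linear_combination h2β - h2β₁ + κ * hbr
  have hmid : |x - 2 * β₁ - κ * Real.log (x / (2 * β₁))| ≤ 4 * b0 + E₀ := by
    rw [key]
    calc |(x - (2 * β - 8 * b0 * A - κ * Real.log (2 * β / x))) + 8 * b0 * (lL - lb - A)|
        ≤ |x - (2 * β - 8 * b0 * A - κ * Real.log (2 * β / x))| + |8 * b0 * (lL - lb - A)| := abs_add_le _ _
      _ ≤ E₀ + 4 * b0 := by
          refine add_le_add hend ?_
          rw [abs_of_nonneg (by positivity)]; nlinarith
      _ = 4 * b0 + E₀ := by ring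
  exact abs_sub_le_of_log hκ0 hx (by linarith) hxκ hyκ hmid

/-- **Clause (iii), label part.**  Under the same data the CALIBRATED label `w = x/4 − 2b₀ log b + (b₁/b₀) log(2b₀/(x/2))` (= `invRunningCoupling (x/2) b`) is within
`b₀ + E₀/4` of `v`: its two-loop term cancels the flow's. [cite: LuscherWeiszWolff1991, §2] -/
theorem clause_iii_label {x β v E₀ lL lb A : ℝ} (hx : 0 < x) (hβ : 0 < β)
    (h2β : 2 * β = 4 * v + 8 * b0 * lL - (4 * b1 / b0) * Real.log (2 * b0 / β))
    (hθ0 : 0 ≤ lL - lb - A) (hθ1 : lL - lb - A ≤ 1 / 2)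
    (hend : |x - (2 * β - 8 * b0 * A - (4 * b1 / b0) * Real.log (2 * β / x))| ≤ E₀) :
    |x / 4 - 2 * b0 * lb + (b1 / b0) * Real.log (2 * b0 / (x / 2)) - v| ≤ b0 + E₀ / 4 := by
  have hb0 : 0 < b0 := by unfold b0; positivity
  have hbr := log_bracket_label hβ hx
  have key : x / 4 - 2 * b0 * lb + (b1 / b0) * Real.log (2 * b0 / (x / 2)) - v =
      (x - (2 * β - 8 * b0 * A - (4 * b1 / b0) * Real.log (2 * β / x))) / 4 + 2 * b0 * (lL - lb - A) := by
    linear_combination (1 / 4) * h2β + (b1 / b0) * hbr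
  rw [key]
  calc |(x - (2 * β - 8 * b0 * A - (4 * b1 / b0) * Real.log (2 * β / x))) / 4 + 2 * b0 * (lL - lb - A)|
      ≤ |(x - (2 * β - 8 * b0 * A - (4 * b1 / b0) * Real.log (2 * β / x))) / 4| + |2 * b0 * (lL - lb - A)| := abs_add_le _ _
    _ ≤ E₀ / 4 + b0 := by
        refine add_le_add ?_ ?_
        · rw [abs_div, abs_of_pos (by norm_num : (0:ℝ) < 4)]; linarith
        · rw [abs_of_nonneg (by positivity)]; nlinarith
    _ = b0 + E₀ / 4 := by ring

/-- **Clause (iii), cube roots.**  `Λ³ = 1/v`, `Λ'³ = 1/w`, `|w − v| ≤ C_w`, `v ≥ 2C_w` (all positive) ⇒ `|Λ'/Λ − 1| ≤ 2C_w/v`. [folklore] -/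
theorem clause_iii_cube {v w Λ Λ' Cw : ℝ} (hv : 0 < v) (hw : 0 < w) (hΛ : 0 < Λ) (hΛ' : 0 < Λ')
    (hΛ3 : Λ ^ 3 = v⁻¹) (hΛ'3 : Λ' ^ 3 = w⁻¹) (hwv : |w - v| ≤ Cw) (hvC : 2 * Cw ≤ v) :
    |Λ' / Λ - 1| ≤ 2 * Cw / v := by
  have hρ : 0 < Λ' / Λ := div_pos hΛ' hΛ
  have hρ3 : (Λ' / Λ) ^ 3 = v / w := by
    rw [div_pow, hΛ3, hΛ'3]; field_simp
  have hCw : 0 ≤ Cw := le_trans (abs_nonneg _) hwv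
  have hw2 : v / 2 ≤ w := by have := (abs_le.1 hwv).1; linarith
  have h1 : |(Λ' / Λ) ^ 3 - 1| ≤ 2 * Cw / v := by
    rw [hρ3, div_sub_one hw.ne', abs_div, abs_of_pos hw, abs_sub_comm]
    rw [div_le_div_iff₀ hw hv]
    have := mul_le_mul_of_nonneg_left hw2 (by positivity : (0:ℝ) ≤ 2 * Cw)
    nlinarith [hwv, abs_nonneg (w - v)]
  exact (abs_sub_one_le_abs_cube hρ).trans h1

/-- **Clause (iii), time.**  `s ≤ T·(Λ/L) ≤ s + Λ/L`, `Λ/L ≤ lam/2`, `|Λ'/Λ − 1| ≤ η ≤ 1` ⇒ `|T·Λ'/L − s| ≤ lam + s·η`. [folklore] -/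
theorem clause_iii_time {T Λ Λ' L s lam η : ℝ} (hs : 0 ≤ s) (hL : 0 < L) (hΛ : 0 < Λ)
    (hT1 : s ≤ T * (Λ / L)) (hT2 : T * (Λ / L) ≤ s + Λ / L) (hΛL : Λ / L ≤ lam / 2)
    (hρ : |Λ' / Λ - 1| ≤ η) (hη1 : η ≤ 1) : |T * Λ' / L - s| ≤ lam + s * η := by
  obtain ⟨hρ1, hρ2⟩ := abs_le.1 hρ
  have hu : T * Λ' / L = (T * (Λ / L)) * (Λ' / Λ) := by field_simp
  rw [hu]
  set u := T * (Λ / L) with hu'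
  set ρ := Λ' / Λ with hρ'
  have hsplit : u * ρ - s = (u - s) * ρ + s * (ρ - 1) := by ring
  rw [hsplit]
  have hus : 0 ≤ u - s := by linarith
  have hus2 : u - s ≤ Λ / L := by linarith
  have hρ0 : 0 ≤ ρ := by linarith
  have hρ2' : ρ ≤ 2 := by linarith
  calc |(u - s) * ρ + s * (ρ - 1)| ≤ |(u - s) * ρ| + |s * (ρ - 1)| := abs_add_le _ _
    _ = (u - s) * ρ + s * |ρ - 1| := by rw [abs_mul, abs_mul, abs_of_nonneg hus, abs_of_nonneg hρ0, abs_of_nonneg hs]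
    _ ≤ (Λ / L) * 2 + s * η := add_le_add (mul_le_mul hus2 hρ2' hρ0 (by positivity)) (mul_le_mul_of_nonneg_left hρ hs)
    _ ≤ lam + s * η := by linarith

end Track

end Summit.QuantumFields.YangMills.Theorems.FemtoTransferGap.TwoLattice

end
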